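import Mathlib
import HarnessLib
import Literature.NumberTheory.LFunctions.BourgainDecouplingMeanValueProofs

/-!
# Bourgain's Theorem 2 from the bilinear estimate (2.23): the Bourgain–Guth induction on scales

Topic `Literature/NumberTheory/LFunctions`. Third file of the cluster
`BourgainDecouplingMeanValue.lean` / `BourgainDecouplingMeanValueProofs.lean` on the mean value
`A₆(N, δ, Δ)` (`Literature.NumberTheory.LFunctions.bourgainA6`) of J. Bourgain, *Decoupling,
exponential sums and the Riemann zeta function*, J. Amer. Math. Soc. 30 (2017), §3, Theorem 2
(2.12) and Corollary 3 (2.28) — the one new input ("The only input of this paper is to provide an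
optimal result for the first spacing problem (see Corollary 3 below)", §1) of the paper into the
Bombieri–Iwaniec–Huxley–Watt method behind its Theorem 4
(`Literature.NumberTheory.LFunctions.Bourgain2017_theorem4_log`, where it is the hypothesis `hC3`
of `Literature.NumberTheory.LFunctions.Bourgain2017_theorem4_log_of_reduction`).

The printed proof of Theorem 2 (pp. 9–10) has two halves:

1. the **bilinear estimate (2.23)**: for an interval `I = [N₀, N₀ + M] ⊂ [1, N]`, `100 M < N₀ ≤ N`,
   and `I₁, I₂ ⊂ I` subintervals of size `∼ M` that are `∼ M`-separated,
   `∫ ∏_{j=1,2} |∑_{n ∈ I_j} e(n x₁ + n² x₂ + N^{1/2} n^{3/2} x₃ + N^{1/2} n^{1/2} x₄)|⁶ dx`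
   `≪ M^{6+ε} {1 + N₀^{3/2}/(N^{1/2} M)} {1 + N₀^{7/2}/(N^{1/2} M³)} ≪ N^{4+ε} M²` — this is where the
   decoupling theorem of the paper enters (Theorem 1 for `d = 4`, two further 2D decouplings with
   periodicity, (2.1)–(2.10), and the Taylor reductions (2.13)–(2.22));
2. the **multilinear-to-linear reduction (2.24)–(2.27)** ("We use the same reduction procedure to
   multi-linear (here bi-linear) inequalities as in [B], [B-D2] (and originating from [B-G])"):
   a block `∑_{n ∈ I_s}` is cut into `K` consecutive pieces; pointwise either three adjacent pieces
   dominate ("narrow", factor `4¹²`) or two non-adjacent pieces are both large ("broad", a bilinear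
   term with factor `K¹⁸`) — this is (2.25); the broad terms are bounded by (2.23), the narrow ones
   are cut again, and summing the geometric series in `(4¹²/K)^α` ((2.26)–(2.27)) gives
   `b(N) ≪ N^ε`, i.e. Theorem 2.

This file PROVES half 2 in full: `Literature.NumberTheory.LFunctions.Bourgain2017_theorem2_of_eq223`
derives the printed Theorem 2 (2.12), `∀ ε > 0, ∃ C, ∀ N ≥ 1, A₆(N, 1/N², 1/N) ≤ C N^{6+ε}` (the
explicit hypothesis of `Literature.NumberTheory.LFunctions.Bourgain2017_corollary3_of_theorem2`), from
the bilinear estimate (2.23) written out as an explicit hypothesis `h223`; composed with the proved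
rescaling, `Literature.NumberTheory.LFunctions.Bourgain2017_corollary3_of_eq223` gives Corollary 3
(2.28) in exactly the shape `hC3` consumed by `Bourgain2017_theorem4_log_of_reduction`. After this
file the unproved content of `hC3` is precisely the decoupling inequality (2.23) ⇐ (2.10) ⇐ Theorem 1
+ [B-D1] (1.5), i.e. half 1.

## The hypothesis `h223` (the printed (2.23), written out)

For every `ε > 0` a constant `C = C(ε)` such that for all `N ≥ 1`, all containers
`[N₀, N₀ + M] ⊂ [1, N]` with `100 M < N₀` (`N₀ M : ℕ`, `N₀ + M ≤ N`), and all pairs of integer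
intervals `[a, b]`, `[a', b']` inside the container with `b < a'` and `dist = a' - b ≥ M/4`
("`∼ M`-separated"; the implied constant of (2.23) depends on the separation ratio, fixed here as
`1/4`, which is all the recursion uses: two non-adjacent pieces among `K` equal consecutive ones are
separated by at least a third of the block spanned by them),
`∫_{[0,1]²×[-1,1]²} |S_{[a,b]}(x)|⁶ |S_{[a',b']}(x)|⁶ dx ≤ C N^{4+ε} M²`, where
`S_J(x) = ∑_{n ∈ J} e(n x₁ + n² x₂ + N^{1/2} n^{3/2} x₃ + N^{1/2} n^{1/2} x₄)` is the sum of (2.12)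
restricted to `J` (phase `Literature.NumberTheory.LFunctions.bourgainA6Phase N (1/N²) (1/N)`, cf.
`bourgainA6Phase_theorem2`). The printed (2.23) is stated for `I₁, I₂` "of size `∼ M`"; it holds
verbatim for all subintervals because its source (2.10) carries arbitrary bounded coefficients
`‖ā‖_∞` (take `a_n` the indicator of the subinterval in (2.22)). Nothing else is assumed: no
monotonicity in `N`, no rescaling `N ↦ 100N/K` (the printed first term of (2.24) is replaced by a
dyadic decomposition of `[1, N]` at fixed `N`, see below), so no weighted/smoothed variant of `A₆`
is needed and the statement proved is the sharp-box (2.12) of the tree.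

## Proof architecture (all PROVED; helper lemmas in namespace `BourgainTheorem2`)

* `broad_narrow` — the pointwise dichotomy behind (2.25): for reals `r_s ≥ 0`, `s < m`,
  `(∑ r_s)¹² ≤ 4¹² ∑ r_s¹² + m¹⁸ ∑_{|s-s'| ≥ 2} r_s⁶ r_{s'}⁶` (if some piece non-adjacent to the
  largest one `η` is `≥ η/m` the sum is broad, else it is `≤ 3η + m·η/m = 4η`).
* `one_step` — (2.25) integrated over the box: cutting `[u, u+L)` into `K` consecutive pieces of
  length `q` (`L ≤ Kq`),
  `∫|S_{[u,u+L)}|¹² ≤ 4¹² ∑_s ∫|S_{piece s}|¹² + K¹⁸ ∑_{|s-s'|≥2} ∫ |S_{piece s}|⁶ |S_{piece s'}|⁶`.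
* `level_bound` — the recursion (2.26)–(2.27) at FIXED `N`, as an induction on the level `t`:
  for every block `[u, u + L) ⊂ [1, N]` with `100 L < u` ("`100 M < N₀`") and `L ≤ K^{t+2}`,
  `∫|S_{[u,u+L)}|¹² ≤ (4¹² K)^t · 4K²⁴ + 2 K²⁴ A K^{2t}`, where `A L²` bounds the bilinear terms
  (`K ≥ 2·4¹²` makes `4¹²·2K²³ + K²⁴ ≤ 2K²⁴`, the geometric series of the paper).
* `top_bound` — `[1, N] = [1, 2⁸) ∪ ⋃_{8 ≤ j} ⋃_{i < 256} [2^j + i 2^{j-8}, 2^j + (i+1) 2^{j-8})`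
  (truncated at `N`): every dyadic piece satisfies `100 L < u`, so `level_bound` applies with
  `t = log_K N`; Hölder over the `≤ 256 (log₂ N + 8)` pieces costs a power of `log N`. (This replaces
  the paper's treatment of `I₀ = [0, 100N/K]` through `b(100N/K)`, which would require comparing
  `A₆` at two values of `N`.)
* bookkeeping: `(4¹²)^{log_K N} ≤ N^{ε/4}` for `K ≥ 4^{48/ε}` (`pow_level_le_rpow`),
  `log₂ N + 8 ≪_ε N^{ε/48}` (`shells_le_rpow`), and the bilinear constant at `ε/2`.

## References

* J. Bourgain, *Decoupling, exponential sums and the Riemann zeta function*, J. Amer. Math. Soc.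
  30 (2017), 205–224, doi:10.1090/jams/860, arXiv:1408.5794 — §3: Theorem 2 (2.12), the bilinear
  estimate (2.13)–(2.23), the reduction (2.24)–(2.27), Corollary 3 (2.28).
* J. Bourgain, L. Guth, *Bounds on oscillatory integral operators based on multilinear
  estimates*, Geom. Funct. Anal. 21 (2011), 1239–1295 ([B-G] of the paper: the broad/narrow
  multilinear-to-linear argument).
-/

noncomputable section

open Complex MeasureTheory Finset
open scoped Real

namespace Literature.NumberTheory.LFunctions

namespace BourgainTheorem2

/-! ### The pointwise broad/narrow dichotomy and two power-mean inequalities -/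

/-- **The pointwise dichotomy behind Bourgain's (2.25)** ([B-G] broad/narrow): for non-negative
reals `r_0, …, r_{m-1}`, `(∑ r_s)¹² ≤ 4¹² ∑ r_s¹² + m¹⁸ ∑_{|s - s'| ≥ 2} r_s⁶ r_{s'}⁶`. With `η` the
largest `r_s`: if some `r_{s₂}` with `|s₂ - s| ≥ 2` has `η ≤ m r_{s₂}`, then
`(∑ r)¹² ≤ (mη)¹² ≤ m¹⁸ η⁶ r_{s₂}⁶`; otherwise `∑ r ≤ 3η + m (η/m) = 4η` ("considering the decreasing
rearrangement … and distinguishing the cases", p. 9). [cite: BourgainJAMS2017, §3 eqs. (2.24)–(2.27)] -/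
theorem broad_narrow (m : ℕ) (r : ℕ → ℝ) (hr : ∀ s, 0 ≤ r s) :
    (∑ s ∈ range m, r s) ^ 12 ≤
      4 ^ 12 * ∑ s ∈ range m, r s ^ 12 +
        (m : ℝ) ^ 18 * ∑ s ∈ range m, ∑ s' ∈ range m,
          (if s + 2 ≤ s' ∨ s' + 2 ≤ s then r s ^ 6 * r s' ^ 6 else 0) := by
  rcases Nat.eq_zero_or_pos m with rfl | hm
  · simp
  -- the maximal piece
  obtain ⟨t, ht, hmax⟩ := exists_max_image (range m) r ⟨0, by simpa using hm⟩
  set η := r t with hη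
  have hη0 : 0 ≤ η := hr t
  have hsum_nonneg : 0 ≤ ∑ s ∈ range m, r s := sum_nonneg fun s _ => hr s
  have hdouble_nonneg : ∀ s ∈ range m, ∀ s' ∈ range m,
      (0 : ℝ) ≤ (if s + 2 ≤ s' ∨ s' + 2 ≤ s then r s ^ 6 * r s' ^ 6 else 0) := by
    intro s _ s' _
    split_ifs
    · exact mul_nonneg (pow_nonneg (hr s) 6) (pow_nonneg (hr s') 6)
    · exact le_rfl
  have hD : 0 ≤ ∑ s ∈ range m, ∑ s' ∈ range m,
      (if s + 2 ≤ s' ∨ s' + 2 ≤ s then r s ^ 6 * r s' ^ 6 else 0) :=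
    sum_nonneg fun s hs => sum_nonneg fun s' hs' => hdouble_nonneg s hs s' hs'
  have h12 : 0 ≤ ∑ s ∈ range m, r s ^ 12 := sum_nonneg fun s _ => pow_nonneg (hr s) 12
  by_cases hfar : ∃ s₂ ∈ range m, (t + 2 ≤ s₂ ∨ s₂ + 2 ≤ t) ∧ η ≤ m * r s₂
  · -- broad case: a far piece is comparable to the maximal one
    obtain ⟨s₂, hs₂, hfar₂, hbig⟩ := hfar
    have hS : ∑ s ∈ range m, r s ≤ m * η := by
      calc ∑ s ∈ range m, r s ≤ ∑ s ∈ range m, η := sum_le_sum fun s hs => hmax s hs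
        _ = m * η := by simp
    have hterm : r t ^ 6 * r s₂ ^ 6 ≤ ∑ s ∈ range m, ∑ s' ∈ range m,
        (if s + 2 ≤ s' ∨ s' + 2 ≤ s then r s ^ 6 * r s' ^ 6 else 0) := by
      have h1 : (if t + 2 ≤ s₂ ∨ s₂ + 2 ≤ t then r t ^ 6 * r s₂ ^ 6 else 0) ≤
          ∑ s' ∈ range m, (if t + 2 ≤ s' ∨ s' + 2 ≤ t then r t ^ 6 * r s' ^ 6 else 0) :=
        single_le_sum (f := fun s' => if t + 2 ≤ s' ∨ s' + 2 ≤ t then r t ^ 6 * r s' ^ 6 else 0)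
          (fun s' hs' => hdouble_nonneg t ht s' hs') hs₂
      have h2 : ∑ s' ∈ range m, (if t + 2 ≤ s' ∨ s' + 2 ≤ t then r t ^ 6 * r s' ^ 6 else 0) ≤
          ∑ s ∈ range m, ∑ s' ∈ range m,
            (if s + 2 ≤ s' ∨ s' + 2 ≤ s then r s ^ 6 * r s' ^ 6 else 0) :=
        single_le_sum (f := fun s => ∑ s' ∈ range m,
            (if s + 2 ≤ s' ∨ s' + 2 ≤ s then r s ^ 6 * r s' ^ 6 else 0))
          (fun s hs => sum_nonneg fun s' hs' => hdouble_nonneg s hs s' hs') ht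
      rw [if_pos hfar₂] at h1
      exact h1.trans h2
    calc (∑ s ∈ range m, r s) ^ 12 ≤ (m * η) ^ 12 := by gcongr
      _ = (m : ℝ) ^ 12 * η ^ 6 * η ^ 6 := by ring
      _ ≤ (m : ℝ) ^ 12 * η ^ 6 * (m * r s₂) ^ 6 := by gcongr
      _ = (m : ℝ) ^ 18 * (r t ^ 6 * r s₂ ^ 6) := by rw [hη]; ring
      _ ≤ (m : ℝ) ^ 18 * ∑ s ∈ range m, ∑ s' ∈ range m,
          (if s + 2 ≤ s' ∨ s' + 2 ≤ s then r s ^ 6 * r s' ^ 6 else 0) := by gcongr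
      _ ≤ _ := le_add_of_nonneg_left (by positivity)
  · -- narrow case: every far piece is `< η / m`
    push Not at hfar
    have hnear : ∑ s ∈ (range m).filter (fun s => ¬ (t + 2 ≤ s ∨ s + 2 ≤ t)), r s ≤ 3 * η := by
      have hsub : (range m).filter (fun s => ¬ (t + 2 ≤ s ∨ s + 2 ≤ t)) ⊆ Icc (t - 1) (t + 1) := by
        intro s hs
        simp only [mem_filter, mem_range, not_or, not_le] at hs
        simp only [mem_Icc]
        omega
      calc ∑ s ∈ (range m).filter (fun s => ¬ (t + 2 ≤ s ∨ s + 2 ≤ t)), r s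
          ≤ ∑ s ∈ (range m).filter (fun s => ¬ (t + 2 ≤ s ∨ s + 2 ≤ t)), η :=
            sum_le_sum fun s hs => hmax s (mem_of_mem_filter s hs)
        _ = ((range m).filter (fun s => ¬ (t + 2 ≤ s ∨ s + 2 ≤ t))).card * η := by simp
        _ ≤ (Icc (t - 1) (t + 1)).card * η := by gcongr
        _ ≤ 3 * η := by
            gcongr
            have : (Icc (t - 1) (t + 1)).card ≤ 3 := by simp [Nat.card_Icc]; omega
            exact_mod_cast this
    have hfar' : ∑ s ∈ (range m).filter (fun s => t + 2 ≤ s ∨ s + 2 ≤ t), r s ≤ η := by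
      calc ∑ s ∈ (range m).filter (fun s => t + 2 ≤ s ∨ s + 2 ≤ t), r s
          ≤ ∑ s ∈ (range m).filter (fun s => t + 2 ≤ s ∨ s + 2 ≤ t), η / m := by
            refine sum_le_sum fun s hs => ?_
            simp only [mem_filter] at hs
            have h := hfar s hs.1 hs.2
            rw [le_div_iff₀ (by exact_mod_cast hm)]
            linarith [h]
        _ = ((range m).filter (fun s => t + 2 ≤ s ∨ s + 2 ≤ t)).card * (η / m) := by simp
        _ ≤ (range m).card * (η / m) := by gcongr; exact filter_subset _ _
        _ = η := by
            rw [card_range]; field_simp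
    have hS : ∑ s ∈ range m, r s ≤ 4 * η := by
      rw [← sum_filter_add_sum_filter_not (range m) (fun s => t + 2 ≤ s ∨ s + 2 ≤ t)]
      linarith
    have hηle : η ^ 12 ≤ ∑ s ∈ range m, r s ^ 12 :=
      single_le_sum (f := fun s => r s ^ 12) (fun s _ => pow_nonneg (hr s) 12) ht
    calc (∑ s ∈ range m, r s) ^ 12 ≤ (4 * η) ^ 12 := by gcongr
      _ = 4 ^ 12 * η ^ 12 := by ring
      _ ≤ 4 ^ 12 * ∑ s ∈ range m, r s ^ 12 := by gcongr
      _ ≤ _ := le_add_of_nonneg_right (by positivity)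

/-- Power mean: `(∑_{i ∈ s} r_i)¹² ≤ |s|¹¹ ∑ r_i¹²` for `r_i ≥ 0`. [folklore] -/
theorem pow_twelve_sum_le' (s : Finset ℕ) (r : ℕ → ℝ) (hr : ∀ i, 0 ≤ r i) :
    (∑ i ∈ s, r i) ^ 12 ≤ (s.card : ℝ) ^ 11 * ∑ i ∈ s, r i ^ 12 := by
  have h := pow_sum_le_card_mul_sum_pow (s := s) (f := r) (fun i _ => hr i) 11
  simpa using h

/-- `(u + v)¹² ≤ 2¹¹ (u¹² + v¹²)` for `u, v ≥ 0`. [folklore] -/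
theorem pow_twelve_add_le {u v : ℝ} (hu : 0 ≤ u) (hv : 0 ≤ v) :
    (u + v) ^ 12 ≤ 2 ^ 11 * (u ^ 12 + v ^ 12) := by
  have h := pow_sum_le_card_mul_sum_pow (s := (univ : Finset (Fin 2))) (f := ![u, v])
    (by intro i _; fin_cases i <;> simp [hu, hv]) 11
  simpa [Fin.sum_univ_two] using h

/-! ### Block sums `S_J(x) = ∑_{n ∈ J} g_n(x)` of unimodular continuous terms on the box

Everything up to `top_bound` is proved for an arbitrary family `g : ℕ → ℝ⁴ → ℂ` of continuous
functions with `‖g_n(x)‖ ≤ 1`; the application takes `g_n(x) = e(φ_N(x, n))` with the phase of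
(2.12). The box is `Literature.NumberTheory.LFunctions.bourgainA6Box = [0,1]² × [-1,1]²` (measure `4`).
-/

/-- A continuous function is integrable on the (compact) box `[0,1]² × [-1,1]²`. [folklore] -/
theorem integrableOn_box {F : (Fin 4 → ℝ) → ℝ} (hF : Continuous F) :
    IntegrableOn F bourgainA6Box := by
  unfold bourgainA6Box
  exact hF.continuousOn.integrableOn_compact isCompact_Icc

/-- Block sums of continuous terms are continuous. [folklore] -/
theorem continuous_blockSum {g : ℕ → (Fin 4 → ℝ) → ℂ} (hgc : ∀ n, Continuous (g n))
    (J : Finset ℕ) : Continuous fun x => ∑ n ∈ J, g n x :=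
  continuous_finsetSum J fun n _ => hgc n

/-- The trivial bound `|S_J(x)| ≤ |J|` for unimodular (or smaller) terms. [folklore] -/
theorem norm_blockSum_le {g : ℕ → (Fin 4 → ℝ) → ℂ} (hg : ∀ n x, ‖g n x‖ ≤ 1)
    (J : Finset ℕ) (x : Fin 4 → ℝ) : ‖∑ n ∈ J, g n x‖ ≤ J.card := by
  calc ‖∑ n ∈ J, g n x‖ ≤ ∑ n ∈ J, ‖g n x‖ := norm_sum_le _ _
    _ ≤ ∑ n ∈ J, (1 : ℝ) := sum_le_sum fun n _ => hg n x
    _ = J.card := by simp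

/-- The trivial bound `∫_box |S_J|¹² ≤ 4 |J|¹²` (box of measure `4`). [folklore] -/
theorem setIntegral_pow_twelve_le_card {g : ℕ → (Fin 4 → ℝ) → ℂ} (hg : ∀ n x, ‖g n x‖ ≤ 1)
    (J : Finset ℕ) :
    ∫ x in bourgainA6Box, ‖∑ n ∈ J, g n x‖ ^ 12 ≤ 4 * (J.card : ℝ) ^ 12 := by
  have hvol : volume bourgainA6Box < ⊤ := by
    unfold bourgainA6Box; exact measure_Icc_lt_top
  have hb : ∀ x ∈ bourgainA6Box, ‖‖∑ n ∈ J, g n x‖ ^ 12‖ ≤ (J.card : ℝ) ^ 12 := by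
    intro x _
    rw [Real.norm_of_nonneg (by positivity)]
    exact pow_le_pow_left₀ (norm_nonneg _) (norm_blockSum_le hg J x) 12
  have h := norm_setIntegral_le_of_norm_le_const hvol hb
  rw [volume_real_bourgainA6Box] at h
  have h' : ∫ x in bourgainA6Box, ‖∑ n ∈ J, g n x‖ ^ 12 ≤
      ‖∫ x in bourgainA6Box, ‖∑ n ∈ J, g n x‖ ^ 12‖ := Real.le_norm_self _
  linarith

/-- Cutting a block into consecutive pieces: for all `K`,
`∑_{s < K} ∑_{n ∈ [u + s q, u + min((s+1) q, L))} f(n) = ∑_{n ∈ [u, u + min(K q, L))} f(n)`.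
[folklore] -/
theorem sum_pieces (f : ℕ → ℂ) (u q L : ℕ) :
    ∀ K : ℕ, ∑ s ∈ range K, ∑ n ∈ Ico (u + s * q) (u + min ((s + 1) * q) L), f n =
      ∑ n ∈ Ico u (u + min (K * q) L), f n := by
  intro K
  induction K with
  | zero => simp
  | succ K ih =>
      rw [sum_range_succ, ih]
      by_cases hKq : K * q ≤ L
      · rw [Nat.min_eq_left hKq]
        apply sum_Ico_consecutive
        · omega
        · exact Nat.add_le_add_left (le_min (by nlinarith) hKq) u
      · push Not at hKq
        have h1 : min (K * q) L = L := Nat.min_eq_right hKq.le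
        have h2 : min ((K + 1) * q) L = L := Nat.min_eq_right (by nlinarith)
        have h3 : Ico (u + K * q) (u + min ((K + 1) * q) L) = ∅ := by
          rw [h2]; exact Ico_eq_empty (by omega)
        rw [h1, h3, sum_empty, add_zero, h2]

/-- A block of length `L ≤ K q` is the union of its `K` consecutive pieces of length `≤ q`
("make a further partition of `I_s` in consecutive intervals `I_{s,1}, …, I_{s,K}`", p. 9).
[folklore] -/
theorem sum_pieces' (f : ℕ → ℂ) {u q L K : ℕ} (hcover : L ≤ K * q) :
    ∑ n ∈ Ico u (u + L), f n =
      ∑ s ∈ range K, ∑ n ∈ Ico (u + s * q) (u + min ((s + 1) * q) L), f n := by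
  rw [sum_pieces f u q L K, Nat.min_eq_right hcover]

/-- **Bourgain's (2.25), integrated over the box**: cutting `[u, u + L)` (`L ≤ K q`) into the `K`
consecutive pieces `P_s = [u + s q, u + min((s+1) q, L))`,
`∫|S_{[u,u+L)}|¹² ≤ 4¹² ∑_s ∫|S_{P_s}|¹² + K¹⁸ ∑_{|s - s'| ≥ 2} ∫ |S_{P_s}|⁶ |S_{P_{s'}}|⁶`
(pointwise `|S| ≤ ∑_s |S_{P_s}|`, then `broad_narrow`, then linearity of the integral).
[cite: BourgainJAMS2017, §3 eqs. (2.24)–(2.27)] -/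
theorem one_step {g : ℕ → (Fin 4 → ℝ) → ℂ} (hgc : ∀ n, Continuous (g n))
    (K u q L : ℕ) (hcover : L ≤ K * q) :
    ∫ x in bourgainA6Box, ‖∑ n ∈ Ico u (u + L), g n x‖ ^ 12 ≤
      4 ^ 12 * (∑ s ∈ range K,
          ∫ x in bourgainA6Box, ‖∑ n ∈ Ico (u + s * q) (u + min ((s + 1) * q) L), g n x‖ ^ 12) +
        (K : ℝ) ^ 18 * ∑ s ∈ range K, ∑ s' ∈ range K,
          (if s + 2 ≤ s' ∨ s' + 2 ≤ s then
            (∫ x in bourgainA6Box,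
              ‖∑ n ∈ Ico (u + s * q) (u + min ((s + 1) * q) L), g n x‖ ^ 6 *
                ‖∑ n ∈ Ico (u + s' * q) (u + min ((s' + 1) * q) L), g n x‖ ^ 6)
           else 0) := by
  -- notation for the pieces
  set P : ℕ → Finset ℕ := fun s => Ico (u + s * q) (u + min ((s + 1) * q) L) with hP
  have hsplit : ∀ x, ∑ n ∈ Ico u (u + L), g n x = ∑ s ∈ range K, ∑ n ∈ P s, g n x :=
    fun x => sum_pieces' (fun n => g n x) hcover
  -- pointwise bound
  have hpt : ∀ x, ‖∑ n ∈ Ico u (u + L), g n x‖ ^ 12 ≤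
      4 ^ 12 * ∑ s ∈ range K, ‖∑ n ∈ P s, g n x‖ ^ 12 +
        (K : ℝ) ^ 18 * ∑ s ∈ range K, ∑ s' ∈ range K,
          (if s + 2 ≤ s' ∨ s' + 2 ≤ s then
            ‖∑ n ∈ P s, g n x‖ ^ 6 * ‖∑ n ∈ P s', g n x‖ ^ 6 else 0) := by
    intro x
    have h1 : ‖∑ n ∈ Ico u (u + L), g n x‖ ≤ ∑ s ∈ range K, ‖∑ n ∈ P s, g n x‖ := by
      rw [hsplit x]; exact norm_sum_le _ _
    have h2 := broad_narrow K (fun s => ‖∑ n ∈ P s, g n x‖) (fun s => norm_nonneg _)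
    exact (pow_le_pow_left₀ (norm_nonneg _) h1 12).trans h2
  -- integrability of everything in sight
  have hcP : ∀ s, Continuous fun x => ‖∑ n ∈ P s, g n x‖ := fun s =>
    (continuous_blockSum hgc (P s)).norm
  have hI12 : ∀ s, IntegrableOn (fun x => ‖∑ n ∈ P s, g n x‖ ^ 12) bourgainA6Box :=
    fun s => integrableOn_box ((hcP s).pow 12)
  have hI66 : ∀ s s', IntegrableOn (fun x => if s + 2 ≤ s' ∨ s' + 2 ≤ s then
      ‖∑ n ∈ P s, g n x‖ ^ 6 * ‖∑ n ∈ P s', g n x‖ ^ 6 else 0) bourgainA6Box := by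
    intro s s'
    split_ifs
    · exact integrableOn_box (((hcP s).pow 6).mul ((hcP s').pow 6))
    · exact integrableOn_zero
  have hIsum66 : ∀ s, IntegrableOn (fun x => ∑ s' ∈ range K,
      (if s + 2 ≤ s' ∨ s' + 2 ≤ s then
        ‖∑ n ∈ P s, g n x‖ ^ 6 * ‖∑ n ∈ P s', g n x‖ ^ 6 else 0)) bourgainA6Box :=
    fun s => integrable_finsetSum (range K) fun s' _ => hI66 s s'
  have hIA : IntegrableOn (fun x => 4 ^ 12 * ∑ s ∈ range K, ‖∑ n ∈ P s, g n x‖ ^ 12)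
      bourgainA6Box :=
    (integrable_finsetSum (range K) fun s _ => hI12 s).const_mul _
  have hIB : IntegrableOn (fun x => (K : ℝ) ^ 18 * ∑ s ∈ range K, ∑ s' ∈ range K,
      (if s + 2 ≤ s' ∨ s' + 2 ≤ s then
        ‖∑ n ∈ P s, g n x‖ ^ 6 * ‖∑ n ∈ P s', g n x‖ ^ 6 else 0)) bourgainA6Box :=
    (integrable_finsetSum (range K) fun s _ => hIsum66 s).const_mul _
  have hIL : IntegrableOn (fun x => ‖∑ n ∈ Ico u (u + L), g n x‖ ^ 12) bourgainA6Box :=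
    integrableOn_box ((continuous_blockSum hgc _).norm.pow 12)
  have hmeas : MeasurableSet bourgainA6Box := by unfold bourgainA6Box; exact measurableSet_Icc
  have hIAB : IntegrableOn (fun x => 4 ^ 12 * ∑ s ∈ range K, ‖∑ n ∈ P s, g n x‖ ^ 12 +
      (K : ℝ) ^ 18 * ∑ s ∈ range K, ∑ s' ∈ range K,
        (if s + 2 ≤ s' ∨ s' + 2 ≤ s then
          ‖∑ n ∈ P s, g n x‖ ^ 6 * ‖∑ n ∈ P s', g n x‖ ^ 6 else 0)) bourgainA6Box :=
    hIA.add hIB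
  -- integrate the pointwise bound
  have hmono := setIntegral_mono_on hIL hIAB hmeas fun x _ => hpt x
  have heq : (∫ x in bourgainA6Box, (4 ^ 12 * ∑ s ∈ range K, ‖∑ n ∈ P s, g n x‖ ^ 12 +
      (K : ℝ) ^ 18 * ∑ s ∈ range K, ∑ s' ∈ range K,
        (if s + 2 ≤ s' ∨ s' + 2 ≤ s then
          ‖∑ n ∈ P s, g n x‖ ^ 6 * ‖∑ n ∈ P s', g n x‖ ^ 6 else 0))) =
      4 ^ 12 * (∑ s ∈ range K, ∫ x in bourgainA6Box, ‖∑ n ∈ P s, g n x‖ ^ 12) +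
        (K : ℝ) ^ 18 * ∑ s ∈ range K, ∑ s' ∈ range K,
          (if s + 2 ≤ s' ∨ s' + 2 ≤ s then
            (∫ x in bourgainA6Box, ‖∑ n ∈ P s, g n x‖ ^ 6 * ‖∑ n ∈ P s', g n x‖ ^ 6)
           else 0) := by
    have h3 : ∀ s ∈ range K, (∫ x in bourgainA6Box, ∑ s' ∈ range K,
        (if s + 2 ≤ s' ∨ s' + 2 ≤ s then
          ‖∑ n ∈ P s, g n x‖ ^ 6 * ‖∑ n ∈ P s', g n x‖ ^ 6 else 0)) =
        ∑ s' ∈ range K, (if s + 2 ≤ s' ∨ s' + 2 ≤ s then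
            (∫ x in bourgainA6Box, ‖∑ n ∈ P s, g n x‖ ^ 6 * ‖∑ n ∈ P s', g n x‖ ^ 6)
           else 0) := by
      intro s _
      rw [integral_finsetSum (range K) fun s' _ => hI66 s s']
      refine sum_congr rfl fun s' _ => ?_
      split_ifs
      · rfl
      · simp
    rw [integral_add hIA hIB, integral_const_mul, integral_const_mul,
      integral_finsetSum (range K) fun s _ => hI12 s,
      integral_finsetSum (range K) fun s _ => hIsum66 s, sum_congr rfl h3]
  have hfin := hmono.trans heq.le
  simp only [hP] at hfin
  exact hfin

/-! ### Arithmetic of the pieces -/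

/-- `q = ⌈L/K⌉ = (L + K - 1)/K` covers: `L ≤ K q` (`K ≥ 1`). [folklore] -/
theorem le_mul_ceilDiv {K : ℕ} (hK : 0 < K) (L : ℕ) : L ≤ K * ((L + K - 1) / K) := by
  have h := Nat.lt_div_mul_add (a := L + K - 1) hK
  rw [mul_comm]
  omega

/-- `⌈L/K⌉ ≤ L` (`K ≥ 1`). [folklore] -/
theorem ceilDiv_le_self {K : ℕ} (hK : 0 < K) (L : ℕ) : (L + K - 1) / K ≤ L := by
  rcases Nat.eq_zero_or_pos L with rfl | hL
  · simp only [zero_add]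
    exact Nat.le_zero.mpr (Nat.div_eq_of_lt (by omega))
  · rw [Nat.div_le_iff_le_mul_add_pred hK]
    have h2 : L ≤ K * L := Nat.le_mul_of_pos_left L hK
    omega

/-- `L ≤ K^{t+3}` gives `⌈L/K⌉ ≤ K^{t+2}`: the pieces of a level-`(t+1)` block are level-`t`
blocks. [folklore] -/
theorem ceilDiv_le_pow {K L t : ℕ} (hK : 0 < K) (hL : L ≤ K ^ (t + 3)) :
    (L + K - 1) / K ≤ K ^ (t + 2) := by
  apply Nat.le_of_lt_succ
  rw [Nat.div_lt_iff_lt_mul hK]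
  have h1 : K ^ (t + 3) = K ^ (t + 2) * K := pow_succ K (t + 2)
  have h2 : (K ^ (t + 2) + 1) * K = K ^ (t + 2) * K + K := by ring
  have h3 : L + K - 1 < L + K := by omega
  rw [h2, ← h1]
  omega

/-- The `s`-th piece `[u + s q, u + min((s+1) q, L))` written as a block `[u', u' + L')` (both
sides are empty when `s q > L`). [folklore] -/
theorem piece_eq (u s q L : ℕ) :
    Ico (u + s * q) (u + min ((s + 1) * q) L) =
      Ico (u + s * q) (u + s * q + (min ((s + 1) * q) L - s * q)) := by
  ext n
  simp only [mem_Ico]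
  have : (s + 1) * q = s * q + q := by ring
  omega

/-- Pieces have length `≤ q`. [folklore] -/
theorem piece_len_le (s q L : ℕ) : min ((s + 1) * q) L - s * q ≤ q := by
  have : (s + 1) * q = s * q + q := by ring
  omega

/-- Two non-adjacent pieces (`s + 2 ≤ s'`) are separated by at least a quarter of the block they
span: `(s'+1) q - s q ≤ 4 ((s' q + 1) - (s+1) q)`. [folklore] -/
theorem far_sep {s s' q : ℕ} (h : s + 2 ≤ s') :
    (s' + 1) * q - s * q ≤ 4 * ((s' * q + 1) - (s + 1) * q) := by
  obtain ⟨d, rfl⟩ := Nat.exists_eq_add_of_le h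
  have e1 : (s + 2 + d + 1) * q - s * q = (d + 3) * q := by
    have : (s + 2 + d + 1) * q = s * q + (d + 3) * q := by ring
    omega
  have e2 : (s + 2 + d) * q + 1 - (s + 1) * q = (d + 1) * q + 1 := by
    have : (s + 2 + d) * q = (s + 1) * q + (d + 1) * q := by ring
    omega
  rw [e1, e2]
  nlinarith

/-! ### The recursion (2.26)–(2.27) at fixed `N` -/

/-- **The level recursion of (2.24)–(2.27), at fixed `N`.** Let `g_n` be continuous with
`‖g_n‖ ≤ 1`, `K ≥ 2·4¹²`, `A ≥ 0`, and assume the bilinear bound `hA`: for integer blocks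
`[u₁, v₁)`, `[u₂, v₂)` with `u₁ < v₁ ≤ u₂ < v₂ ≤ N + 1`, container `[u₁, v₂)` of length
`v₂ - u₁` with `100 (v₂ - u₁) < u₁` and separation `u₂ + 1 - v₁ ≥ (v₂ - u₁)/4`,
`∫_box |S_{[u₁,v₁)}|⁶ |S_{[u₂,v₂)}|⁶ ≤ A (v₂ - u₁)²` (this is (2.23) with `A = C N^{4+ε}`). Then for every
level `t` and every block `[u, u + L) ⊂ [1, N]` with `100 L < u` and `L ≤ K^{t+2}`,
`∫_box |S_{[u,u+L)}|¹² ≤ (4¹² K)^t · 4 K²⁴ + 2 K²⁴ A K^{2t}`.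
Induction on `t`: `t = 0` is the trivial bound `4 L¹² ≤ 4 K²⁴`; at level `t + 1` cut into `K`
pieces of length `⌈L/K⌉ ≤ K^{t+2}` (`one_step`), bound the `K` narrow terms by the level-`t` bound
and the `≤ K²` broad terms by `A L² ≤ A K^{2t+6}`:
`4¹² K [(4¹²K)^t 4K²⁴ + 2K²⁴ A K^{2t}] + K¹⁸ K² A K^{2t+6} ≤ (4¹²K)^{t+1} 4K²⁴ + 2 K²⁴ A K^{2t+2}`
because `2·4¹² K²³ + K²⁴ ≤ 2 K²⁴` ("`(2.26) ≪ … N^{6+ε} (4¹²/K)^α`. Summing over `α` …", p. 10).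
[cite: BourgainJAMS2017, §3 eqs. (2.24)–(2.27)] -/
theorem level_bound {g : ℕ → (Fin 4 → ℝ) → ℂ} (hg : ∀ n x, ‖g n x‖ ≤ 1)
    (hgc : ∀ n, Continuous (g n)) {K N : ℕ} (hK : 2 * 4 ^ 12 ≤ K) {A : ℝ} (hA0 : 0 ≤ A)
    (hA : ∀ u₁ v₁ u₂ v₂ : ℕ, u₁ < v₁ → v₁ ≤ u₂ → u₂ < v₂ → v₂ ≤ N + 1 →
      100 * (v₂ - u₁) < u₁ → v₂ - u₁ ≤ 4 * (u₂ + 1 - v₁) →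
        ∫ x in bourgainA6Box, ‖∑ n ∈ Ico u₁ v₁, g n x‖ ^ 6 * ‖∑ n ∈ Ico u₂ v₂, g n x‖ ^ 6 ≤
          A * ((v₂ - u₁ : ℕ) : ℝ) ^ 2) :
    ∀ t u L : ℕ, L ≤ K ^ (t + 2) → u + L ≤ N + 1 → 100 * L < u →
      ∫ x in bourgainA6Box, ‖∑ n ∈ Ico u (u + L), g n x‖ ^ 12 ≤
        (4 ^ 12 * (K : ℝ)) ^ t * (4 * (K : ℝ) ^ 24) +
          2 * (K : ℝ) ^ 24 * A * (K : ℝ) ^ (2 * t) := by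
  have hKpos : 0 < K := lt_of_lt_of_le (by norm_num) hK
  have hK1 : (1 : ℝ) ≤ K := by exact_mod_cast hKpos
  have hKR : (2 * 4 ^ 12 : ℝ) ≤ K := by exact_mod_cast hK
  intro t
  induction t with
  | zero =>
      intro u L hL _ _
      have h1 := setIntegral_pow_twelve_le_card hg (Ico u (u + L))
      have hcard : ((Ico u (u + L)).card : ℝ) ≤ (K : ℝ) ^ 2 := by
        rw [Nat.card_Ico]
        have : u + L - u = L := by omega
        rw [this]; exact_mod_cast hL
      calc ∫ x in bourgainA6Box, ‖∑ n ∈ Ico u (u + L), g n x‖ ^ 12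
          ≤ 4 * ((Ico u (u + L)).card : ℝ) ^ 12 := h1
        _ ≤ 4 * ((K : ℝ) ^ 2) ^ 12 := by gcongr
        _ = (4 ^ 12 * (K : ℝ)) ^ 0 * (4 * (K : ℝ) ^ 24) := by ring
        _ ≤ _ := le_add_of_nonneg_right (by positivity)
  | succ t ih =>
      intro u L hL huL h100
      -- the bound at level `t` is below the bound at level `t + 1`
      have hmono : (4 ^ 12 * (K : ℝ)) ^ t * (4 * (K : ℝ) ^ 24) +
          2 * (K : ℝ) ^ 24 * A * (K : ℝ) ^ (2 * t) ≤
          (4 ^ 12 * (K : ℝ)) ^ (t + 1) * (4 * (K : ℝ) ^ 24) +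
          2 * (K : ℝ) ^ 24 * A * (K : ℝ) ^ (2 * (t + 1)) := by
        have h1 : (4 ^ 12 * (K : ℝ)) ^ t ≤ (4 ^ 12 * (K : ℝ)) ^ (t + 1) :=
          pow_le_pow_right₀ (by nlinarith) (by omega)
        have h2 : (K : ℝ) ^ (2 * t) ≤ (K : ℝ) ^ (2 * (t + 1)) :=
          pow_le_pow_right₀ hK1 (by omega)
        have h3 : 0 ≤ 2 * (K : ℝ) ^ 24 * A := by positivity
        have h4 : (0 : ℝ) ≤ 4 * (K : ℝ) ^ 24 := by positivity
        exact add_le_add (mul_le_mul_of_nonneg_right h1 h4) (mul_le_mul_of_nonneg_left h2 h3)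
      rcases le_or_gt L (K ^ (t + 2)) with hsmall | hbig
      · exact (ih u L hsmall huL h100).trans hmono
      -- genuine level `t + 1`: split into `K` pieces of length `q = ⌈L/K⌉`
      set q := (L + K - 1) / K with hq
      have hcover : L ≤ K * q := le_mul_ceilDiv hKpos L
      have hqL : q ≤ L := ceilDiv_le_self hKpos L
      have hqK : q ≤ K ^ (t + 2) := ceilDiv_le_pow hKpos hL
      have hLpos : 0 < L := lt_of_le_of_lt (Nat.zero_le _) hbig
      have hqpos : 0 < q := by
        rcases Nat.eq_zero_or_pos q with h0 | h0
        · rw [h0, mul_zero] at hcover; omega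
        · exact h0
      have hstep := one_step hgc K u q L hcover
      -- narrow part: each piece is admissible at level `t`
      have hnarrow : ∀ s ∈ range K,
          ∫ x in bourgainA6Box, ‖∑ n ∈ Ico (u + s * q) (u + min ((s + 1) * q) L), g n x‖ ^ 12 ≤
            (4 ^ 12 * (K : ℝ)) ^ t * (4 * (K : ℝ) ^ 24) +
              2 * (K : ℝ) ^ 24 * A * (K : ℝ) ^ (2 * t) := by
        intro s _
        by_cases hsq : s * q ≤ L
        · rw [piece_eq u s q L]
          have e : (s + 1) * q = s * q + q := by ring
          have hlen := piece_len_le s q L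
          refine ih (u + s * q) (min ((s + 1) * q) L - s * q) ?_ ?_ ?_
          · exact hlen.trans hqK
          · have : min ((s + 1) * q) L ≤ L := min_le_right _ _
            omega
          · omega
        · -- empty piece
          have hempty : Ico (u + s * q) (u + min ((s + 1) * q) L) = ∅ :=
            Ico_eq_empty (by push Not at hsq; omega)
          simp [hempty]
          positivity
      -- broad part: far pairs
      have hfar_lt : ∀ s s' : ℕ, s + 2 ≤ s' → s' * q < L →
          ∫ x in bourgainA6Box,
            ‖∑ n ∈ Ico (u + s * q) (u + min ((s + 1) * q) L), g n x‖ ^ 6 *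
              ‖∑ n ∈ Ico (u + s' * q) (u + min ((s' + 1) * q) L), g n x‖ ^ 6 ≤
            A * (L : ℝ) ^ 2 := by
        intro s s' hss' hs'L
        have e1 : (s + 1) * q ≤ s' * q := Nat.mul_le_mul_right q (by omega)
        have e2 : s' * q < (s' + 1) * q := by nlinarith
        have hmin1 : min ((s + 1) * q) L = (s + 1) * q := Nat.min_eq_left (by omega)
        rw [hmin1]
        have hsep := far_sep (q := q) hss'
        have es : (s + 1) * q = s * q + q := by ring
        have key := hA (u + s * q) (u + (s + 1) * q) (u + s' * q) (u + min ((s' + 1) * q) L)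
          (by omega) (by omega) (by omega) (by omega) (by omega) (by omega)
        refine key.trans ?_
        gcongr
        · exact_mod_cast (show u + min ((s' + 1) * q) L - (u + s * q) ≤ L by omega)
      have hfar : ∀ s ∈ range K, ∀ s' ∈ range K,
          (if s + 2 ≤ s' ∨ s' + 2 ≤ s then
            (∫ x in bourgainA6Box,
              ‖∑ n ∈ Ico (u + s * q) (u + min ((s + 1) * q) L), g n x‖ ^ 6 *
                ‖∑ n ∈ Ico (u + s' * q) (u + min ((s' + 1) * q) L), g n x‖ ^ 6)
           else 0) ≤ A * (L : ℝ) ^ 2 := by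
        intro s _ s' _
        split_ifs with hc
        · rcases hc with hc | hc
          · by_cases hs'L : s' * q < L
            · exact hfar_lt s s' hc hs'L
            · -- the far piece is empty
              have hempty : Ico (u + s' * q) (u + min ((s' + 1) * q) L) = ∅ :=
                Ico_eq_empty (by push Not at hs'L; omega)
              simp [hempty]
              positivity
          · by_cases hsL : s * q < L
            · have h := hfar_lt s' s hc hsL
              calc (∫ x in bourgainA6Box,
                    ‖∑ n ∈ Ico (u + s * q) (u + min ((s + 1) * q) L), g n x‖ ^ 6 *
                      ‖∑ n ∈ Ico (u + s' * q) (u + min ((s' + 1) * q) L), g n x‖ ^ 6)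
                  = ∫ x in bourgainA6Box,
                    ‖∑ n ∈ Ico (u + s' * q) (u + min ((s' + 1) * q) L), g n x‖ ^ 6 *
                      ‖∑ n ∈ Ico (u + s * q) (u + min ((s + 1) * q) L), g n x‖ ^ 6 := by
                    congr 1; ext x; ring
                _ ≤ A * (L : ℝ) ^ 2 := h
            · have hempty : Ico (u + s * q) (u + min ((s + 1) * q) L) = ∅ :=
                Ico_eq_empty (by push Not at hsL; omega)
              simp [hempty]
              positivity
        · positivity
      -- assemble
      have hsum_narrow : ∑ s ∈ range K,
          ∫ x in bourgainA6Box, ‖∑ n ∈ Ico (u + s * q) (u + min ((s + 1) * q) L), g n x‖ ^ 12 ≤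
            K * ((4 ^ 12 * (K : ℝ)) ^ t * (4 * (K : ℝ) ^ 24) +
              2 * (K : ℝ) ^ 24 * A * (K : ℝ) ^ (2 * t)) := by
        calc _ ≤ ∑ s ∈ range K, ((4 ^ 12 * (K : ℝ)) ^ t * (4 * (K : ℝ) ^ 24) +
              2 * (K : ℝ) ^ 24 * A * (K : ℝ) ^ (2 * t)) := sum_le_sum hnarrow
          _ = _ := by rw [sum_const, card_range, nsmul_eq_mul]
      have hsum_far : ∑ s ∈ range K, ∑ s' ∈ range K,
          (if s + 2 ≤ s' ∨ s' + 2 ≤ s then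
            (∫ x in bourgainA6Box,
              ‖∑ n ∈ Ico (u + s * q) (u + min ((s + 1) * q) L), g n x‖ ^ 6 *
                ‖∑ n ∈ Ico (u + s' * q) (u + min ((s' + 1) * q) L), g n x‖ ^ 6)
           else 0) ≤ K * (K * (A * (L : ℝ) ^ 2)) := by
        calc _ ≤ ∑ s ∈ range K, ∑ s' ∈ range K, A * (L : ℝ) ^ 2 :=
              sum_le_sum fun s hs => sum_le_sum fun s' hs' => hfar s hs s' hs'
          _ = _ := by rw [sum_const, card_range, nsmul_eq_mul, sum_const, card_range, nsmul_eq_mul]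
      have hLR : (L : ℝ) ≤ (K : ℝ) ^ (t + 3) := by exact_mod_cast hL
      calc ∫ x in bourgainA6Box, ‖∑ n ∈ Ico u (u + L), g n x‖ ^ 12
          ≤ 4 ^ 12 * (K * ((4 ^ 12 * (K : ℝ)) ^ t * (4 * (K : ℝ) ^ 24) +
              2 * (K : ℝ) ^ 24 * A * (K : ℝ) ^ (2 * t))) +
            (K : ℝ) ^ 18 * (K * (K * (A * (L : ℝ) ^ 2))) := by
            refine hstep.trans ?_
            gcongr
        _ ≤ 4 ^ 12 * (K * ((4 ^ 12 * (K : ℝ)) ^ t * (4 * (K : ℝ) ^ 24) +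
              2 * (K : ℝ) ^ 24 * A * (K : ℝ) ^ (2 * t))) +
            (K : ℝ) ^ 18 * (K * (K * (A * ((K : ℝ) ^ (t + 3)) ^ 2))) := by gcongr
        _ = (4 ^ 12 * (K : ℝ)) ^ (t + 1) * (4 * (K : ℝ) ^ 24) +
            (K : ℝ) ^ 23 * A * (K : ℝ) ^ (2 * (t + 1)) * (2 * 4 ^ 12 + K) := by ring
        _ ≤ (4 ^ 12 * (K : ℝ)) ^ (t + 1) * (4 * (K : ℝ) ^ 24) +
            (K : ℝ) ^ 23 * A * (K : ℝ) ^ (2 * (t + 1)) * (K + K) := by gcongr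
        _ = _ := by ring

/-! ### The top level: dyadic decomposition of `[1, N]` -/

/-- Truncating a block at `N`: `∑_{n ∈ [a,b)} 1_{n ≤ N} h(n) = ∑_{n ∈ [a, min(b, N+1))} h(n)`.
[folklore] -/
theorem sum_Ico_trunc (h : ℕ → ℂ) (N a b : ℕ) :
    ∑ n ∈ Ico a b, (if n ≤ N then h n else 0) = ∑ n ∈ Ico a (min b (N + 1)), h n := by
  rw [← sum_filter]
  congr 1
  ext n
  simp only [mem_filter, mem_Ico]
  omega

/-- Dyadic shells telescope: `∑_{8 ≤ j < T} ∑_{2^j ≤ n < 2^{j+1}} = ∑_{2⁸ ≤ n < 2^T}` (`T ≥ 8`).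
[folklore] -/
theorem sum_shells (F : ℕ → ℂ) {T : ℕ} (hT : 8 ≤ T) :
    ∑ j ∈ Ico 8 T, ∑ n ∈ Ico (2 ^ j) (2 ^ (j + 1)), F n = ∑ n ∈ Ico (2 ^ 8) (2 ^ T), F n := by
  induction T, hT using Nat.le_induction with
  | base => simp
  | succ T hT ih =>
      rw [sum_Ico_succ_top hT, ih]
      exact sum_Ico_consecutive _ (Nat.pow_le_pow_right (by norm_num) hT)
        (Nat.pow_le_pow_right (by norm_num) (Nat.le_succ T))

/-- A dyadic shell `[2^j, 2^{j+1})`, `j ≥ 8`, is the union of `256` consecutive pieces of length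
`2^{j-8}`. [folklore] -/
theorem sum_shell_pieces (F : ℕ → ℂ) {j : ℕ} (hj : 8 ≤ j) :
    ∑ n ∈ Ico (2 ^ j) (2 ^ (j + 1)), F n =
      ∑ i ∈ range 256, ∑ n ∈ Ico (2 ^ j + i * 2 ^ (j - 8))
        (2 ^ j + min ((i + 1) * 2 ^ (j - 8)) (2 ^ j)), F n := by
  have h2j : 2 ^ j = 256 * 2 ^ (j - 8) := by
    have : j = 8 + (j - 8) := by omega
    conv_lhs => rw [this, pow_add]
    norm_num
  rw [sum_pieces F (2 ^ j) (2 ^ (j - 8)) (2 ^ j) 256, ← h2j, min_self, ← two_mul, ← pow_succ']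

/-- `[u, w) = [u, u + (w - u))` (both empty when `w < u`). [folklore] -/
theorem Ico_eq_Ico_add_sub (u w : ℕ) : Ico u w = Ico u (u + (w - u)) := by
  ext n; simp only [mem_Ico]; omega

/-- **The top level.** Under the hypotheses of `level_bound` and `N ≥ 1`,
`∫_box |S_{[1,N]}|¹² ≤ 2¹¹·4·255¹² + 2¹¹ 256¹² T¹² [(4¹²K)^t 4K²⁴ + 2K²⁴ A K^{2t}]` with
`T = max(log₂ N + 1, 8)` and `t = log_K N`: write
`[1, N] = [1, min(2⁸, N+1)) ∪ ⋃_{8 ≤ j < T} ⋃_{i < 256} ([2^j + i 2^{j-8}, 2^j + (i+1) 2^{j-8}) ∩ [1, N])`;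
each dyadic piece `[u, u + L)` has `100 L ≤ 100·2^{j-8} < 2^j ≤ u` and `L ≤ N < K^{t+1}`, so
`level_bound` applies at level `t`; the first block has `≤ 255` terms; and
`(|S₀| + ∑_{j,i} |S_{j,i}|)¹² ≤ 2¹¹ |S₀|¹² + 2¹¹ (T-8)¹¹ 256¹¹ ∑_{j,i} |S_{j,i}|¹²` (power means) is
integrated term by term. This replaces the first term `2¹² ∫|∑_{n ∈ I₀}|¹²`, `I₀ = [0, 100N/K]`, of the
printed (2.24) (handled there through `b(100N/K)`) by finitely many blocks with `100 M < N₀` at the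
same `N`. [cite: BourgainJAMS2017, §3 eqs. (2.24)–(2.27)] -/
theorem top_bound {g : ℕ → (Fin 4 → ℝ) → ℂ} (hg : ∀ n x, ‖g n x‖ ≤ 1)
    (hgc : ∀ n, Continuous (g n)) {K N : ℕ} (hK : 2 * 4 ^ 12 ≤ K) (hN : 1 ≤ N)
    {A : ℝ} (hA0 : 0 ≤ A)
    (hA : ∀ u₁ v₁ u₂ v₂ : ℕ, u₁ < v₁ → v₁ ≤ u₂ → u₂ < v₂ → v₂ ≤ N + 1 →
      100 * (v₂ - u₁) < u₁ → v₂ - u₁ ≤ 4 * (u₂ + 1 - v₁) →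
        ∫ x in bourgainA6Box, ‖∑ n ∈ Ico u₁ v₁, g n x‖ ^ 6 * ‖∑ n ∈ Ico u₂ v₂, g n x‖ ^ 6 ≤
          A * ((v₂ - u₁ : ℕ) : ℝ) ^ 2) :
    ∫ x in bourgainA6Box, ‖∑ n ∈ Icc 1 N, g n x‖ ^ 12 ≤
      2 ^ 11 * (4 * 255 ^ 12) +
        2 ^ 11 * 256 ^ 12 * ((max (Nat.log 2 N + 1) 8 : ℕ) : ℝ) ^ 12 *
          ((4 ^ 12 * (K : ℝ)) ^ (Nat.log K N) * (4 * (K : ℝ) ^ 24) +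
            2 * (K : ℝ) ^ 24 * A * (K : ℝ) ^ (2 * Nat.log K N)) := by
  -- parameters
  set T := max (Nat.log 2 N + 1) 8 with hTdef
  set t := Nat.log K N with htdef
  set Φ := (4 ^ 12 * (K : ℝ)) ^ t * (4 * (K : ℝ) ^ 24) +
    2 * (K : ℝ) ^ 24 * A * (K : ℝ) ^ (2 * t) with hΦdef
  have hΦ0 : 0 ≤ Φ := by positivity
  have hT8 : 8 ≤ T := le_max_right _ _
  have hK1 : 1 < K := lt_of_lt_of_le (by norm_num) hK
  have hNT : N < 2 ^ T :=
    (Nat.lt_pow_succ_log_self (by norm_num) N).trans_le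
      (Nat.pow_le_pow_right (by norm_num) (le_max_left _ _))
  have hNK : N < K ^ (t + 1) := Nat.lt_pow_succ_log_self hK1 N
  -- the pieces
  set Q : ℕ → ℕ → Finset ℕ := fun j i => Ico (2 ^ j + i * 2 ^ (j - 8))
    (min (2 ^ j + min ((i + 1) * 2 ^ (j - 8)) (2 ^ j)) (N + 1)) with hQ
  set Q₀ : Finset ℕ := Ico 1 (min (2 ^ 8) (N + 1)) with hQ₀
  -- (c) the decomposition of `S_{[1,N]}`
  have hdec : ∀ x, ∑ n ∈ Icc 1 N, g n x =
      ∑ n ∈ Q₀, g n x + ∑ j ∈ Ico 8 T, ∑ i ∈ range 256, ∑ n ∈ Q j i, g n x := by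
    intro x
    set F : ℕ → ℂ := fun n => if n ≤ N then g n x else 0 with hF
    have hF : ∀ a b, ∑ n ∈ Ico a b, F n = ∑ n ∈ Ico a (min b (N + 1)), g n x :=
      fun a b => sum_Ico_trunc (fun n => g n x) N a b
    have h1 : ∑ n ∈ Icc 1 N, g n x = ∑ n ∈ Ico 1 (2 ^ T), F n := by
      rw [hF 1 (2 ^ T), Nat.min_eq_right (by omega)]
      rfl
    have h2 : ∑ n ∈ Ico 1 (2 ^ T), F n = ∑ n ∈ Ico 1 (2 ^ 8), F n + ∑ n ∈ Ico (2 ^ 8) (2 ^ T), F n :=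
      (sum_Ico_consecutive _ (by norm_num) (Nat.pow_le_pow_right (by norm_num) hT8)).symm
    have h3 : ∑ n ∈ Ico (2 ^ 8) (2 ^ T), F n =
        ∑ j ∈ Ico 8 T, ∑ i ∈ range 256, ∑ n ∈ Q j i, g n x := by
      rw [← sum_shells F hT8]
      refine sum_congr rfl fun j hj => ?_
      rw [sum_shell_pieces F (mem_Ico.mp hj).1]
      refine sum_congr rfl fun i _ => ?_
      rw [hF]
    rw [h1, h2, h3, hF 1 (2 ^ 8)]
  -- (d) pointwise bound
  have hpt : ∀ x, ‖∑ n ∈ Icc 1 N, g n x‖ ^ 12 ≤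
      2 ^ 11 * ‖∑ n ∈ Q₀, g n x‖ ^ 12 +
        2 ^ 11 * ((T - 8 : ℕ) : ℝ) ^ 11 * 256 ^ 11 *
          ∑ j ∈ Ico 8 T, ∑ i ∈ range 256, ‖∑ n ∈ Q j i, g n x‖ ^ 12 := by
    intro x
    have hn : ‖∑ n ∈ Icc 1 N, g n x‖ ≤
        ‖∑ n ∈ Q₀, g n x‖ + ∑ j ∈ Ico 8 T, ∑ i ∈ range 256, ‖∑ n ∈ Q j i, g n x‖ := by
      rw [hdec x]
      refine (norm_add_le _ _).trans (add_le_add le_rfl ?_)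
      refine (norm_sum_le _ _).trans (sum_le_sum fun j _ => norm_sum_le _ _)
    have hR : 0 ≤ ∑ j ∈ Ico 8 T, ∑ i ∈ range 256, ‖∑ n ∈ Q j i, g n x‖ :=
      sum_nonneg fun j _ => sum_nonneg fun i _ => norm_nonneg _
    have hJ1 := pow_twelve_sum_le' (Ico 8 T) (fun j => ∑ i ∈ range 256, ‖∑ n ∈ Q j i, g n x‖)
      (fun j => sum_nonneg fun i _ => norm_nonneg _)
    rw [Nat.card_Ico] at hJ1
    have hJ2 : ∀ j, (∑ i ∈ range 256, ‖∑ n ∈ Q j i, g n x‖) ^ 12 ≤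
        256 ^ 11 * ∑ i ∈ range 256, ‖∑ n ∈ Q j i, g n x‖ ^ 12 := by
      intro j
      have h := pow_twelve_sum_le' (range 256) (fun i => ‖∑ n ∈ Q j i, g n x‖)
        (fun i => norm_nonneg _)
      rw [card_range] at h
      exact_mod_cast h
    calc ‖∑ n ∈ Icc 1 N, g n x‖ ^ 12
        ≤ (‖∑ n ∈ Q₀, g n x‖ + ∑ j ∈ Ico 8 T, ∑ i ∈ range 256, ‖∑ n ∈ Q j i, g n x‖) ^ 12 :=
          pow_le_pow_left₀ (norm_nonneg _) hn 12
      _ ≤ 2 ^ 11 * (‖∑ n ∈ Q₀, g n x‖ ^ 12 +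
          (∑ j ∈ Ico 8 T, ∑ i ∈ range 256, ‖∑ n ∈ Q j i, g n x‖) ^ 12) :=
          pow_twelve_add_le (norm_nonneg _) hR
      _ ≤ 2 ^ 11 * (‖∑ n ∈ Q₀, g n x‖ ^ 12 +
          ((T - 8 : ℕ) : ℝ) ^ 11 * ∑ j ∈ Ico 8 T,
            (∑ i ∈ range 256, ‖∑ n ∈ Q j i, g n x‖) ^ 12) := by gcongr
      _ ≤ 2 ^ 11 * (‖∑ n ∈ Q₀, g n x‖ ^ 12 +
          ((T - 8 : ℕ) : ℝ) ^ 11 * ∑ j ∈ Ico 8 T,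
            (256 ^ 11 * ∑ i ∈ range 256, ‖∑ n ∈ Q j i, g n x‖ ^ 12)) := by
          gcongr with j _
          exact hJ2 j
      _ = _ := by rw [← mul_sum]; ring
  -- (e) integrate
  have hcQ : ∀ j i, Continuous fun x => ‖∑ n ∈ Q j i, g n x‖ ^ 12 := fun j i =>
    ((continuous_blockSum hgc (Q j i)).norm).pow 12
  have hIQ : ∀ j i, IntegrableOn (fun x => ‖∑ n ∈ Q j i, g n x‖ ^ 12) bourgainA6Box :=
    fun j i => integrableOn_box (hcQ j i)
  have hIQ₀ : IntegrableOn (fun x => ‖∑ n ∈ Q₀, g n x‖ ^ 12) bourgainA6Box :=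
    integrableOn_box (((continuous_blockSum hgc Q₀).norm).pow 12)
  have hIi : ∀ j, IntegrableOn (fun x => ∑ i ∈ range 256, ‖∑ n ∈ Q j i, g n x‖ ^ 12)
      bourgainA6Box := fun j => integrable_finsetSum _ fun i _ => hIQ j i
  have hIji : IntegrableOn (fun x => ∑ j ∈ Ico 8 T, ∑ i ∈ range 256, ‖∑ n ∈ Q j i, g n x‖ ^ 12)
      bourgainA6Box := integrable_finsetSum _ fun j _ => hIi j
  have hI1 : IntegrableOn (fun x => 2 ^ 11 * ‖∑ n ∈ Q₀, g n x‖ ^ 12) bourgainA6Box :=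
    hIQ₀.const_mul _
  have hI2 : IntegrableOn (fun x => 2 ^ 11 * ((T - 8 : ℕ) : ℝ) ^ 11 * 256 ^ 11 *
      ∑ j ∈ Ico 8 T, ∑ i ∈ range 256, ‖∑ n ∈ Q j i, g n x‖ ^ 12) bourgainA6Box :=
    hIji.const_mul _
  have hI12 : IntegrableOn (fun x => 2 ^ 11 * ‖∑ n ∈ Q₀, g n x‖ ^ 12 +
      2 ^ 11 * ((T - 8 : ℕ) : ℝ) ^ 11 * 256 ^ 11 *
        ∑ j ∈ Ico 8 T, ∑ i ∈ range 256, ‖∑ n ∈ Q j i, g n x‖ ^ 12) bourgainA6Box :=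
    hI1.add hI2
  have hIL : IntegrableOn (fun x => ‖∑ n ∈ Icc 1 N, g n x‖ ^ 12) bourgainA6Box :=
    integrableOn_box (((continuous_blockSum hgc _).norm).pow 12)
  have hmeas : MeasurableSet bourgainA6Box := by unfold bourgainA6Box; exact measurableSet_Icc
  have hmono := setIntegral_mono_on hIL hI12 hmeas fun x _ => hpt x
  have heq : (∫ x in bourgainA6Box, (2 ^ 11 * ‖∑ n ∈ Q₀, g n x‖ ^ 12 +
      2 ^ 11 * ((T - 8 : ℕ) : ℝ) ^ 11 * 256 ^ 11 *
        ∑ j ∈ Ico 8 T, ∑ i ∈ range 256, ‖∑ n ∈ Q j i, g n x‖ ^ 12)) =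
      2 ^ 11 * (∫ x in bourgainA6Box, ‖∑ n ∈ Q₀, g n x‖ ^ 12) +
        2 ^ 11 * ((T - 8 : ℕ) : ℝ) ^ 11 * 256 ^ 11 *
          ∑ j ∈ Ico 8 T, ∑ i ∈ range 256, (∫ x in bourgainA6Box, ‖∑ n ∈ Q j i, g n x‖ ^ 12) := by
    rw [integral_add hI1 hI2, integral_const_mul, integral_const_mul,
      integral_finsetSum _ fun j _ => hIi j]
    congr 2
    exact sum_congr rfl fun j _ => integral_finsetSum _ fun i _ => hIQ j i
  -- (f) bound each piece
  have hQ₀b : (∫ x in bourgainA6Box, ‖∑ n ∈ Q₀, g n x‖ ^ 12) ≤ 4 * 255 ^ 12 := by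
    refine (setIntegral_pow_twelve_le_card hg Q₀).trans ?_
    have : (Q₀.card : ℝ) ≤ 255 := by
      rw [hQ₀, Nat.card_Ico]
      have : min (2 ^ 8) (N + 1) - 1 ≤ 255 := by omega
      exact_mod_cast this
    gcongr
  have hQb : ∀ j ∈ Ico 8 T, ∀ i ∈ range 256,
      (∫ x in bourgainA6Box, ‖∑ n ∈ Q j i, g n x‖ ^ 12) ≤ Φ := by
    intro j hj i _
    have hj8 : 8 ≤ j := (mem_Ico.mp hj).1
    set e := 2 ^ (j - 8) with he
    have h2j : 2 ^ j = 256 * e := by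
      have : j = 8 + (j - 8) := by omega
      rw [he]; conv_lhs => rw [this, pow_add]
      norm_num
    have epos : 0 < e := by positivity
    have ei : (i + 1) * e = i * e + e := by ring
    by_cases hu : 2 ^ j + i * e ≤ N + 1
    · simp only [hQ]
      rw [← he, Ico_eq_Ico_add_sub]
      refine level_bound hg hgc hK hA0 hA t _ _ ?_ ?_ ?_
      · have : min (2 ^ j + min ((i + 1) * e) (2 ^ j)) (N + 1) - (2 ^ j + i * e) ≤ N := by omega
        calc _ ≤ N := this
          _ ≤ K ^ (t + 1) := hNK.le
          _ ≤ K ^ (t + 2) := Nat.pow_le_pow_right (by omega) (by omega)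
      · omega
      · omega
    · have hempty : Q j i = ∅ := by
        simp only [hQ]
        rw [← he]
        exact Ico_eq_empty (by push Not at hu; omega)
      rw [hempty]
      simp
      exact hΦ0
  -- (g) assemble
  have hsum : ∑ j ∈ Ico 8 T, ∑ i ∈ range 256, (∫ x in bourgainA6Box, ‖∑ n ∈ Q j i, g n x‖ ^ 12) ≤
      ((T - 8 : ℕ) : ℝ) * (256 * Φ) := by
    calc _ ≤ ∑ j ∈ Ico 8 T, ∑ i ∈ range 256, Φ :=
          sum_le_sum fun j hj => sum_le_sum fun i hi => hQb j hj i hi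
      _ = _ := by
          simp only [sum_const, card_range, Nat.card_Ico, nsmul_eq_mul]
          push_cast
          ring
  have hT8R : ((T - 8 : ℕ) : ℝ) ≤ (T : ℝ) := by exact_mod_cast Nat.sub_le T 8
  calc ∫ x in bourgainA6Box, ‖∑ n ∈ Icc 1 N, g n x‖ ^ 12
      ≤ 2 ^ 11 * (∫ x in bourgainA6Box, ‖∑ n ∈ Q₀, g n x‖ ^ 12) +
        2 ^ 11 * ((T - 8 : ℕ) : ℝ) ^ 11 * 256 ^ 11 *
          ∑ j ∈ Ico 8 T, ∑ i ∈ range 256, (∫ x in bourgainA6Box, ‖∑ n ∈ Q j i, g n x‖ ^ 12) :=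
        hmono.trans heq.le
    _ ≤ 2 ^ 11 * (4 * 255 ^ 12) +
        2 ^ 11 * ((T - 8 : ℕ) : ℝ) ^ 11 * 256 ^ 11 * (((T - 8 : ℕ) : ℝ) * (256 * Φ)) := by
        gcongr
    _ = 2 ^ 11 * (4 * 255 ^ 12) + 2 ^ 11 * 256 ^ 12 * ((T - 8 : ℕ) : ℝ) ^ 12 * Φ := by ring
    _ ≤ 2 ^ 11 * (4 * 255 ^ 12) + 2 ^ 11 * 256 ^ 12 * (T : ℝ) ^ 12 * Φ := by gcongr

/-! ### Bookkeeping: logarithms and levels are `N^{o(1)}` -/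

/-- `log_K N ≤ log N / log K` (`N ≥ 1`, `K ≥ 2`). [folklore] -/
theorem natLog_le_div {K N : ℕ} (hK : 2 ≤ K) (hN : 1 ≤ N) :
    (Nat.log K N : ℝ) ≤ Real.log N / Real.log K := by
  have hKR : (1 : ℝ) < K := by exact_mod_cast (lt_of_lt_of_le (by norm_num) hK)
  have hlogK : 0 < Real.log K := Real.log_pos hKR
  have hpow : K ^ Nat.log K N ≤ N := Nat.pow_log_le_self K (by omega)
  have hpowR : ((K : ℝ)) ^ Nat.log K N ≤ N := by exact_mod_cast hpow
  rw [le_div_iff₀ hlogK, ← Real.log_pow]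
  exact Real.log_le_log (by positivity) hpowR

/-- The narrow-case losses are `N^{o(1)}`: `(4¹²)^t ≤ N^{ε/4}` once `t ≤ log N / log K` and
`K ≥ 4^{48/ε}` (then `12 t log 4 ≤ (12 log 4 / log K) log N ≤ (ε/4) log N`). [folklore] -/
theorem pow_level_le_rpow {ε : ℝ} (hε : 0 < ε) {K N t : ℕ} (hN : 1 ≤ N)
    (hK : (4 : ℝ) ^ (48 / ε) ≤ K) (ht : (t : ℝ) ≤ Real.log N / Real.log K) :
    ((4 : ℝ) ^ 12) ^ t ≤ (N : ℝ) ^ (ε / 4) := by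
  have hNpos : (0 : ℝ) < N := by exact_mod_cast hN
  have h4 : (1 : ℝ) < (4 : ℝ) ^ (48 / ε) := Real.one_lt_rpow (by norm_num) (by positivity)
  have hKR : (1 : ℝ) < K := lt_of_lt_of_le h4 hK
  have hlogK : 0 < Real.log K := Real.log_pos hKR
  have hlogK' : 48 / ε * Real.log 4 ≤ Real.log K := by
    rw [← Real.log_rpow (by norm_num)]
    exact Real.log_le_log (by positivity) hK
  have hlog4 : 0 < Real.log 4 := Real.log_pos (by norm_num)
  have hlogN : 0 ≤ Real.log N := Real.log_nonneg (by exact_mod_cast hN)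
  -- compare logarithms
  have key : Real.log (((4 : ℝ) ^ 12) ^ t) ≤ ε / 4 * Real.log N := by
    rw [Real.log_pow, Real.log_pow]
    have h1 : (t : ℝ) * (12 * Real.log 4) ≤ Real.log N / Real.log K * (12 * Real.log 4) :=
      mul_le_mul_of_nonneg_right ht (by positivity)
    have h2 : Real.log N / Real.log K * (12 * Real.log 4) ≤ ε / 4 * Real.log N := by
      rw [div_mul_eq_mul_div, div_le_iff₀ hlogK]
      have h48 : 48 * Real.log 4 ≤ ε * Real.log K := by
        have := mul_le_mul_of_nonneg_left hlogK' hε.le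
        rwa [show ε * (48 / ε * Real.log 4) = 48 * Real.log 4 by field_simp] at this
      have h3 : Real.log N * (12 * Real.log 4) * 4 ≤ Real.log N * (ε * Real.log K) := by
        rw [mul_assoc]
        exact mul_le_mul_of_nonneg_left (by linarith) hlogN
      nlinarith
    push_cast
    linarith
  calc ((4 : ℝ) ^ 12) ^ t = Real.exp (Real.log (((4 : ℝ) ^ 12) ^ t)) :=
        (Real.exp_log (by positivity)).symm
    _ ≤ Real.exp (ε / 4 * Real.log N) := Real.exp_le_exp.mpr key
    _ = (N : ℝ) ^ (ε / 4) := by rw [Real.rpow_def_of_pos hNpos, mul_comm]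

/-- The number of dyadic shells is `N^{o(1)}`: `max(log₂ N + 1, 8) ≤ (48/(ε log 2) + 8) N^{ε/48}`
(`log N ≤ N^η/η`). [folklore] -/
theorem shells_le_rpow {ε : ℝ} (hε : 0 < ε) {N : ℕ} (hN : 1 ≤ N) :
    ((max (Nat.log 2 N + 1) 8 : ℕ) : ℝ) ≤ (48 / (ε * Real.log 2) + 8) * (N : ℝ) ^ (ε / 48) := by
  have hNpos : (0 : ℝ) < N := by exact_mod_cast hN
  have hN1 : (1 : ℝ) ≤ N := by exact_mod_cast hN
  have hlog2 : 0 < Real.log 2 := Real.log_pos (by norm_num)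
  have hη : 0 < ε / 48 := by positivity
  have h1 : (Nat.log 2 N : ℝ) ≤ Real.log N / Real.log 2 := natLog_le_div le_rfl hN
  have h2 : Real.log N ≤ (N : ℝ) ^ (ε / 48) / (ε / 48) := Real.log_le_rpow_div hNpos.le hη
  have hrpow1 : (1 : ℝ) ≤ (N : ℝ) ^ (ε / 48) := Real.one_le_rpow hN1 hη.le
  have hmax : ((max (Nat.log 2 N + 1) 8 : ℕ) : ℝ) ≤ (Nat.log 2 N : ℝ) + 8 := by
    have : max (Nat.log 2 N + 1) 8 ≤ Nat.log 2 N + 8 := by omega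
    exact_mod_cast this
  have h3 : Real.log N / Real.log 2 ≤ 48 / (ε * Real.log 2) * (N : ℝ) ^ (ε / 48) := by
    rw [div_le_iff₀ hlog2]
    have e : 48 / (ε * Real.log 2) * (N : ℝ) ^ (ε / 48) * Real.log 2 =
        (N : ℝ) ^ (ε / 48) / (ε / 48) := by
      field_simp
    rw [e]; exact h2
  calc ((max (Nat.log 2 N + 1) 8 : ℕ) : ℝ) ≤ (Nat.log 2 N : ℝ) + 8 := hmax
    _ ≤ 48 / (ε * Real.log 2) * (N : ℝ) ^ (ε / 48) + 8 * (N : ℝ) ^ (ε / 48) := by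
        have : (8 : ℝ) ≤ 8 * (N : ℝ) ^ (ε / 48) := by nlinarith
        linarith [h1.trans h3]
    _ = (48 / (ε * Real.log 2) + 8) * (N : ℝ) ^ (ε / 48) := by ring

/-- `n^a n^b n^c ≤ n^d` for `n ≥ 1` and `a + b + c ≤ d`. [folklore] -/
theorem rpow_mul_rpow_mul_rpow_le {n : ℝ} (hn : 1 ≤ n) {a b c d : ℝ} (h : a + b + c ≤ d) :
    n ^ a * n ^ b * n ^ c ≤ n ^ d := by
  have hn0 : 0 < n := by linarith
  rw [← Real.rpow_add hn0, ← Real.rpow_add hn0]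
  exact Real.rpow_le_rpow_of_exponent_le hn h

end BourgainTheorem2

open BourgainTheorem2 in
/-- **Bourgain 2017, Theorem 2 (2.12) from the bilinear estimate (2.23): the [B-G]
multilinear-to-linear induction on scales (2.24)–(2.27), PROVED.**

Hypothesis `h223` = the printed (2.23) written out (see the module docstring): for every `ε > 0`
there is `C` such that for all `N ≥ 1`, all `N₀ M : ℕ` with `100 M < N₀`, `N₀ + M ≤ N` (the
container `I = [N₀, N₀ + M] ⊂ [1, N]`, "`100 M < N₀ ≤ N`"), and all integer intervals
`[a, b], [a', b'] ⊂ [N₀, N₀ + M]` with `b < a'` and `M ≤ 4 (a' - b)` ("`∼ M`-separated"),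
`∫_{[0,1]²×[-1,1]²} |∑_{n=a}^{b} e(φ_N(x,n))|⁶ |∑_{n=a'}^{b'} e(φ_N(x,n))|⁶ dx ≤ C N^{4+ε} M²`, where
`φ_N(x, n) = n x₁ + n² x₂ + N^{1/2} n^{3/2} x₃ + N^{1/2} n^{1/2} x₄` is the phase of (2.12)
(`bourgainA6Phase N (1/N²) (1/N)`, `bourgainA6Phase_theorem2`) — "(2.22) and hence (2.13) are
bounded by `M^{6+ε}{1 + N₀^{3/2}/(N^{1/2}M)}{1 + N₀^{7/2}/(N^{1/2}M³)} ≪ N^{4+ε} M²` (2.23)".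
Conclusion = the printed Theorem 2 (2.12), `∀ ε > 0, ∃ C, ∀ N ≥ 1, A₆(N, 1/N², 1/N) ≤ C N^{6+ε}`, in
the shape of the hypothesis of
`Literature.NumberTheory.LFunctions.Bourgain2017_corollary3_of_theorem2`.

Proof ("Returning to (2.12), let `b(N) N⁶` be a bound on the left hand side. We use the same
reduction procedure to multi-linear (here bi-linear) inequalities as in [B], [B-D2] (and originating
from [B-G])", p. 9): given `ε`, take the constant of `h223` at `ε/2`, `K = ⌈4^{48/ε}⌉ + 2·4¹²`, and
for `N ≥ 1` apply `top_bound` to `g_n = e(φ_N(·, n))` with `A = max(C,1) N^{4+ε/2}` (the bilinear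
hypothesis of `level_bound` is `h223` with `N₀ = u₁`, `M = v₂ - 1 - u₁`, `[a,b] = [u₁, v₁ - 1]`,
`[a',b'] = [u₂, v₂ - 1]`); then `K^t ≤ N`, `(4¹²)^t ≤ N^{ε/4}`, `T¹² ≪_ε N^{ε/4}` turn the bound into
`C(ε) N^{6+ε}`. [cite: BourgainJAMS2017, Theorem 2, eq. (2.12); §3 eqs. (2.23)–(2.27)] -/
theorem Bourgain2017_theorem2_of_eq223
    (h223 : ∀ ε : ℝ, 0 < ε → ∃ C : ℝ, ∀ N : ℕ, 1 ≤ N → ∀ N₀ M : ℕ,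
      100 * M < N₀ → N₀ + M ≤ N → ∀ a b a' b' : ℕ,
        N₀ ≤ a → a ≤ b → b < a' → a' ≤ b' → b' ≤ N₀ + M → (M : ℝ) ≤ 4 * ((a' : ℝ) - b) →
          (∫ x in bourgainA6Box,
            ‖∑ n ∈ Finset.Icc a b,
                Complex.exp (2 * ↑π * I * ↑(bourgainA6Phase N (1 / (N : ℝ) ^ 2) (1 / N) x n))‖ ^ 6 *
              ‖∑ n ∈ Finset.Icc a' b',
                Complex.exp (2 * ↑π * I * ↑(bourgainA6Phase N (1 / (N : ℝ) ^ 2) (1 / N) x n))‖ ^ 6) ≤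
            C * (N : ℝ) ^ (4 + ε) * (M : ℝ) ^ 2) :
    ∀ ε : ℝ, 0 < ε → ∃ C : ℝ, ∀ N : ℕ, 1 ≤ N →
      bourgainA6 N (1 / (N : ℝ) ^ 2) (1 / N) ≤ C * (N : ℝ) ^ (6 + ε) := by
  intro ε hε
  obtain ⟨C, hC⟩ := h223 (ε / 2) (by positivity)
  set C₁ := max C 1 with hC₁
  have hC₁0 : 0 ≤ C₁ := le_trans zero_le_one (le_max_right _ _)
  set K : ℕ := ⌈(4 : ℝ) ^ (48 / ε)⌉₊ + 2 * 4 ^ 12 with hKdef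
  have hK : 2 * 4 ^ 12 ≤ K := Nat.le_add_left _ _
  have hK4 : (4 : ℝ) ^ (48 / ε) ≤ K := by
    refine (Nat.le_ceil _).trans ?_
    exact_mod_cast Nat.le_add_right _ _
  have hK2 : 2 ≤ K := le_trans (by norm_num) hK
  set cT : ℝ := 48 / (ε * Real.log 2) + 8 with hcT
  have hlog2 : 0 < Real.log 2 := Real.log_pos (by norm_num)
  have hcT0 : 0 ≤ cT := by positivity
  refine ⟨2 ^ 11 * (4 * 255 ^ 12) +
    2 ^ 11 * 256 ^ 12 * cT ^ 12 * (4 * (K : ℝ) ^ 24 + 2 * (K : ℝ) ^ 24 * C₁), fun N hN => ?_⟩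
  have hNpos : (0 : ℝ) < N := by exact_mod_cast hN
  have hN1 : (1 : ℝ) ≤ N := by exact_mod_cast hN
  -- the family `g_n(x) = e(φ_N(x, n))`
  set g : ℕ → (Fin 4 → ℝ) → ℂ := fun n x =>
    Complex.exp (2 * ↑π * I * ↑(bourgainA6Phase N (1 / (N : ℝ) ^ 2) (1 / N) x n)) with hgdef
  have hg1 : ∀ n x, ‖g n x‖ ≤ 1 := by
    intro n x
    simp only [hgdef]
    rw [show (2 * ↑π * I * ↑(bourgainA6Phase N (1 / (N : ℝ) ^ 2) (1 / N) x n) : ℂ) =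
        ↑(2 * π * bourgainA6Phase N (1 / (N : ℝ) ^ 2) (1 / N) x n) * I by push_cast; ring,
      Complex.norm_exp_ofReal_mul_I]
  have hgc : ∀ n, Continuous (g n) := by
    intro n
    simp only [hgdef]
    unfold bourgainA6Phase
    fun_prop
  -- the bilinear input at this `N`
  set A : ℝ := C₁ * (N : ℝ) ^ (4 + ε / 2) with hAdef
  have hA0 : 0 ≤ A := by positivity
  have hAb : ∀ u₁ v₁ u₂ v₂ : ℕ, u₁ < v₁ → v₁ ≤ u₂ → u₂ < v₂ → v₂ ≤ N + 1 →
      100 * (v₂ - u₁) < u₁ → v₂ - u₁ ≤ 4 * (u₂ + 1 - v₁) →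
        ∫ x in bourgainA6Box, ‖∑ n ∈ Ico u₁ v₁, g n x‖ ^ 6 * ‖∑ n ∈ Ico u₂ v₂, g n x‖ ^ 6 ≤
          A * ((v₂ - u₁ : ℕ) : ℝ) ^ 2 := by
    intro u₁ v₁ u₂ v₂ h1 h2 h3 h4 h5 h6
    have hsep : ((v₂ - 1 - u₁ : ℕ) : ℝ) ≤ 4 * ((u₂ : ℝ) - ((v₁ - 1 : ℕ) : ℝ)) := by
      have c1 : ((v₂ - 1 - u₁ : ℕ) : ℝ) = (v₂ : ℝ) - 1 - u₁ := by
        rw [Nat.sub_sub, Nat.cast_sub (by omega)]; push_cast; ring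
      have c2 : ((v₁ - 1 : ℕ) : ℝ) = (v₁ : ℝ) - 1 := by
        rw [Nat.cast_sub (by omega)]; push_cast; ring
      have c3 : ((v₂ - u₁ : ℕ) : ℝ) = (v₂ : ℝ) - u₁ := by rw [Nat.cast_sub (by omega)]
      have c4 : ((u₂ + 1 - v₁ : ℕ) : ℝ) = (u₂ : ℝ) + 1 - v₁ := by
        rw [Nat.cast_sub (by omega)]; push_cast; ring
      have h6R : ((v₂ - u₁ : ℕ) : ℝ) ≤ 4 * ((u₂ + 1 - v₁ : ℕ) : ℝ) := by exact_mod_cast h6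
      rw [c3, c4] at h6R
      rw [c1, c2]
      linarith
    have key := hC N hN u₁ (v₂ - 1 - u₁) (by omega) (by omega) u₁ (v₁ - 1) u₂ (v₂ - 1)
      le_rfl (by omega) (by omega) (by omega) (by omega) hsep
    have e1 : Finset.Icc u₁ (v₁ - 1) = Finset.Ico u₁ v₁ := by
      ext n; simp only [Finset.mem_Icc, Finset.mem_Ico]; omega
    have e2 : Finset.Icc u₂ (v₂ - 1) = Finset.Ico u₂ v₂ := by
      ext n; simp only [Finset.mem_Icc, Finset.mem_Ico]; omega
    rw [e1, e2] at key
    refine key.trans ?_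
    have hM : ((v₂ - 1 - u₁ : ℕ) : ℝ) ≤ ((v₂ - u₁ : ℕ) : ℝ) := by
      exact_mod_cast (show v₂ - 1 - u₁ ≤ v₂ - u₁ by omega)
    have hX : 0 ≤ (N : ℝ) ^ (4 + ε / 2) * ((v₂ - 1 - u₁ : ℕ) : ℝ) ^ 2 := by positivity
    calc C * (N : ℝ) ^ (4 + ε / 2) * ((v₂ - 1 - u₁ : ℕ) : ℝ) ^ 2
        = C * ((N : ℝ) ^ (4 + ε / 2) * ((v₂ - 1 - u₁ : ℕ) : ℝ) ^ 2) := by ring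
      _ ≤ C₁ * ((N : ℝ) ^ (4 + ε / 2) * ((v₂ - 1 - u₁ : ℕ) : ℝ) ^ 2) :=
          mul_le_mul_of_nonneg_right (le_max_left _ _) hX
      _ ≤ C₁ * ((N : ℝ) ^ (4 + ε / 2) * ((v₂ - u₁ : ℕ) : ℝ) ^ 2) := by gcongr
      _ = A * ((v₂ - u₁ : ℕ) : ℝ) ^ 2 := by rw [hAdef]; ring
  -- the induction on scales
  have htop := top_bound hg1 hgc hK hN hA0 hAb
  have hA6 : bourgainA6 N (1 / (N : ℝ) ^ 2) (1 / N) =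
      ∫ x in bourgainA6Box, ‖∑ n ∈ Icc 1 N, g n x‖ ^ 12 := rfl
  rw [hA6]
  refine htop.trans ?_
  -- bookkeeping: every factor is a small power of `N`
  set T : ℕ := max (Nat.log 2 N + 1) 8 with hTdef
  set t : ℕ := Nat.log K N with htdef
  have hT : (T : ℝ) ≤ cT * (N : ℝ) ^ (ε / 48) := shells_le_rpow hε hN
  have hT12 : (T : ℝ) ^ 12 ≤ cT ^ 12 * (N : ℝ) ^ (ε / 4) := by
    calc (T : ℝ) ^ 12 ≤ (cT * (N : ℝ) ^ (ε / 48)) ^ 12 := by gcongr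
      _ = cT ^ 12 * ((N : ℝ) ^ (ε / 48)) ^ 12 := mul_pow _ _ _
      _ = cT ^ 12 * (N : ℝ) ^ (ε / 4) := by
          congr 1
          rw [← Real.rpow_natCast ((N : ℝ) ^ (ε / 48)) 12, ← Real.rpow_mul hNpos.le]
          congr 1
          push_cast
          ring
  have ht : (t : ℝ) ≤ Real.log N / Real.log K := natLog_le_div hK2 hN
  have h4t : ((4 : ℝ) ^ 12) ^ t ≤ (N : ℝ) ^ (ε / 4) := pow_level_le_rpow hε hN hK4 ht
  have hKt : (K : ℝ) ^ t ≤ N := by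
    exact_mod_cast Nat.pow_log_le_self K (show N ≠ 0 by omega)
  have hK2t : (K : ℝ) ^ (2 * t) ≤ (N : ℝ) ^ 2 := by
    rw [pow_mul']; gcongr
  have hKR : (0 : ℝ) ≤ K := Nat.cast_nonneg K
  -- first product
  have hP1 : ((4 : ℝ) ^ 12 * K) ^ t * (4 * (K : ℝ) ^ 24) ≤
      4 * (K : ℝ) ^ 24 * ((N : ℝ) ^ (ε / 4) * N) := by
    rw [mul_pow]
    calc ((4 : ℝ) ^ 12) ^ t * (K : ℝ) ^ t * (4 * (K : ℝ) ^ 24)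
        ≤ (N : ℝ) ^ (ε / 4) * N * (4 * (K : ℝ) ^ 24) := by gcongr
      _ = _ := by ring
  have hP2 : 2 * (K : ℝ) ^ 24 * A * (K : ℝ) ^ (2 * t) ≤
      2 * (K : ℝ) ^ 24 * C₁ * ((N : ℝ) ^ (4 + ε / 2) * (N : ℝ) ^ 2) := by
    rw [hAdef]
    calc 2 * (K : ℝ) ^ 24 * (C₁ * (N : ℝ) ^ (4 + ε / 2)) * (K : ℝ) ^ (2 * t)
        ≤ 2 * (K : ℝ) ^ 24 * (C₁ * (N : ℝ) ^ (4 + ε / 2)) * (N : ℝ) ^ 2 := by gcongr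
      _ = _ := by ring
  -- powers of `N` combine below `N^(6+ε)`
  have hE1 : (N : ℝ) ^ (ε / 4) * ((N : ℝ) ^ (ε / 4) * N) ≤ (N : ℝ) ^ (6 + ε) := by
    have h := rpow_mul_rpow_mul_rpow_le hN1 (a := ε / 4) (b := ε / 4) (c := 1) (d := 6 + ε)
      (by linarith)
    rw [Real.rpow_one] at h
    linarith [h]
  have hE2 : (N : ℝ) ^ (ε / 4) * ((N : ℝ) ^ (4 + ε / 2) * (N : ℝ) ^ 2) ≤ (N : ℝ) ^ (6 + ε) := by
    have h := rpow_mul_rpow_mul_rpow_le hN1 (a := ε / 4) (b := 4 + ε / 2) (c := 2) (d := 6 + ε)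
      (by linarith)
    rw [Real.rpow_two] at h
    linarith [h]
  have hE0 : (1 : ℝ) ≤ (N : ℝ) ^ (6 + ε) := Real.one_le_rpow hN1 (by positivity)
  -- assemble
  have hΦ : ((4 : ℝ) ^ 12 * K) ^ t * (4 * (K : ℝ) ^ 24) + 2 * (K : ℝ) ^ 24 * A * (K : ℝ) ^ (2 * t) ≤
      4 * (K : ℝ) ^ 24 * ((N : ℝ) ^ (ε / 4) * N) +
        2 * (K : ℝ) ^ 24 * C₁ * ((N : ℝ) ^ (4 + ε / 2) * (N : ℝ) ^ 2) := add_le_add hP1 hP2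
  have hΦ0 : 0 ≤ ((4 : ℝ) ^ 12 * K) ^ t * (4 * (K : ℝ) ^ 24) +
      2 * (K : ℝ) ^ 24 * A * (K : ℝ) ^ (2 * t) := by positivity
  calc 2 ^ 11 * (4 * 255 ^ 12) + 2 ^ 11 * 256 ^ 12 * (T : ℝ) ^ 12 *
        (((4 : ℝ) ^ 12 * K) ^ t * (4 * (K : ℝ) ^ 24) + 2 * (K : ℝ) ^ 24 * A * (K : ℝ) ^ (2 * t))
      ≤ 2 ^ 11 * (4 * 255 ^ 12) + 2 ^ 11 * 256 ^ 12 * (cT ^ 12 * (N : ℝ) ^ (ε / 4)) *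
        (4 * (K : ℝ) ^ 24 * ((N : ℝ) ^ (ε / 4) * N) +
          2 * (K : ℝ) ^ 24 * C₁ * ((N : ℝ) ^ (4 + ε / 2) * (N : ℝ) ^ 2)) := by gcongr
    _ = 2 ^ 11 * (4 * 255 ^ 12) + 2 ^ 11 * 256 ^ 12 * cT ^ 12 *
        (4 * (K : ℝ) ^ 24 * ((N : ℝ) ^ (ε / 4) * ((N : ℝ) ^ (ε / 4) * N)) +
          2 * (K : ℝ) ^ 24 * C₁ * ((N : ℝ) ^ (ε / 4) * ((N : ℝ) ^ (4 + ε / 2) * (N : ℝ) ^ 2))) := by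
        ring
    _ ≤ 2 ^ 11 * (4 * 255 ^ 12) * (N : ℝ) ^ (6 + ε) + 2 ^ 11 * 256 ^ 12 * cT ^ 12 *
        (4 * (K : ℝ) ^ 24 * (N : ℝ) ^ (6 + ε) + 2 * (K : ℝ) ^ 24 * C₁ * (N : ℝ) ^ (6 + ε)) := by
        have hfirst : (2 : ℝ) ^ 11 * (4 * 255 ^ 12) ≤ 2 ^ 11 * (4 * 255 ^ 12) * (N : ℝ) ^ (6 + ε) :=
          le_mul_of_one_le_right (by positivity) hE0
        have hsecond : 4 * (K : ℝ) ^ 24 * ((N : ℝ) ^ (ε / 4) * ((N : ℝ) ^ (ε / 4) * N)) +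
            2 * (K : ℝ) ^ 24 * C₁ * ((N : ℝ) ^ (ε / 4) * ((N : ℝ) ^ (4 + ε / 2) * (N : ℝ) ^ 2)) ≤
            4 * (K : ℝ) ^ 24 * (N : ℝ) ^ (6 + ε) + 2 * (K : ℝ) ^ 24 * C₁ * (N : ℝ) ^ (6 + ε) :=
          add_le_add (mul_le_mul_of_nonneg_left hE1 (by positivity))
            (mul_le_mul_of_nonneg_left hE2 (by positivity))
        exact add_le_add hfirst (mul_le_mul_of_nonneg_left hsecond (by positivity))
    _ = _ := by ring

/-- **Bourgain 2017, Corollary 3 (2.28) from the bilinear estimate (2.23)**: the composition of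
`Bourgain2017_theorem2_of_eq223` ((2.24)–(2.27), proved here) with the rescaling
`Literature.NumberTheory.LFunctions.Bourgain2017_corollary3_of_theorem2` ("Theorem 2 implies
Corollary 3", proved in `BourgainDecouplingMeanValueProofs.lean`). The conclusion is literally the
hypothesis `hC3` of `Literature.NumberTheory.LFunctions.Bourgain2017_theorem4_log_of_reduction`
(Theorem 4 for `F = log`), so after this file the part of Corollary 3 that remains an assumption in
the discharge of `Literature.NumberTheory.LFunctions.Bourgain2017_theorem4_log` is exactly the
decoupling estimate (2.23) (⇐ (2.10) ⇐ Theorem 1 of the paper and [B-D1] (1.5)).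
[cite: BourgainJAMS2017, Corollary 3, eq. (2.28); §3 eqs. (2.23)–(2.27)] -/
theorem Bourgain2017_corollary3_of_eq223
    (h223 : ∀ ε : ℝ, 0 < ε → ∃ C : ℝ, ∀ N : ℕ, 1 ≤ N → ∀ N₀ M : ℕ,
      100 * M < N₀ → N₀ + M ≤ N → ∀ a b a' b' : ℕ,
        N₀ ≤ a → a ≤ b → b < a' → a' ≤ b' → b' ≤ N₀ + M → (M : ℝ) ≤ 4 * ((a' : ℝ) - b) →
          (∫ x in bourgainA6Box,
            ‖∑ n ∈ Finset.Icc a b,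
                Complex.exp (2 * ↑π * I * ↑(bourgainA6Phase N (1 / (N : ℝ) ^ 2) (1 / N) x n))‖ ^ 6 *
              ‖∑ n ∈ Finset.Icc a' b',
                Complex.exp (2 * ↑π * I * ↑(bourgainA6Phase N (1 / (N : ℝ) ^ 2) (1 / N) x n))‖ ^ 6) ≤
            C * (N : ℝ) ^ (4 + ε) * (M : ℝ) ^ 2) :
    ∀ ε : ℝ, 0 < ε → ∃ C : ℝ, ∀ N : ℕ, 1 ≤ N → ∀ δ Δ : ℝ,
      1 / (N : ℝ) ^ 2 ≤ δ → δ ≤ 1 → 1 / (N : ℝ) ≤ Δ → Δ ≤ 1 →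
        bourgainA6 N δ Δ ≤ C * δ * Δ * (N : ℝ) ^ (9 + ε) :=
  Bourgain2017_corollary3_of_theorem2 (Bourgain2017_theorem2_of_eq223 h223)

end Literature.NumberTheory.LFunctions
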